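import Literature.NumberTheory.Sieve.GoldstonPintzYildirimThetaLemma3T
import Literature.NumberTheory.Sieve.GoldstonPintzYildirimThetaBV
import HarnessLib

/-!
# Goldston–Pintz–Yıldırım, *Primes in tuples I*, Proposition 2 from Lemma 3: the assembly

Trunk: NumberTheory / Sieve. GPY, *Primes in tuples. I* (Ann. of Math. 170 (2009) =
arXiv:math/0508185), §9, last paragraph (p. 20): "We now evaluate `𝒯̃_R` by Lemma 3 in each
case [(9.21)–(9.23): Case 1 `a = k₁, b = k₂, d = r, u = ℓ₁, v = ℓ₂`; Case 2 `a = k₁ − 1`,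
`u = ℓ₁ + 1`; Case 3 moreover `b = k₂ − 1, v = ℓ₂ + 1, d = r − 1`] … which completes the proof of
Proposition 2" — together with the case in which one of `H₁, H₂` is empty ("the argument of §6",
handled here through the dummy second variable of `mainTRTheta_empty_mul_log_eq_lemma3T` and the
symmetry `mainTRTheta_comm`).

This file PROVES the bookkeeping: from an `o(1)`-form of Lemma 3 FOR THE SPECIFIC `G = GStar`
of (9.17)–(9.19) — taken as the inline hypothesis `hL3` of `mainTerm_of_lemma3` (uniform in
`h ≤ R`, `Hᵢ ⊆ [0,h]`, `1 ≤ h₀ ≤ h`, total size `≤ M`; main term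
`C(u+v,u)(log R)^{u+v+d}/(u+v+d)! · 𝔖(H⁰)` by `GStar_zero_zero`) — to the main-term statement
`hMT` of `proposition2_of_mainTerm`, whence `proposition2_of_lemma3 : hL3 → proposition2`.
No new named facts; the discharge `proposition2_holds` then only needs `hL3`, i.e. GPY Lemma 3
applied to `GStar` (holomorphic on `G₂Region`: `differentiableOn_GStar₂_region`; bounded as in
(8.3): `norm_GStar_le`).

## References

* D. A. Goldston, J. Pintz, C. Y. Yıldırım, *Primes in tuples. I*, Ann. of Math. (2) 170 (2009),
  819–862 = arXiv:math/0508185, §8 Lemma 3, §9 (9.20)–(9.23) and last paragraph, p. 20.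
  [cite: GoldstonPintzYildirim2009]
-/

noncomputable section

open Finset Complex
open Literature.NumberTheory.LFunctions.Nicolas (zetaOne)

namespace Literature.NumberTheory.Sieve.GPY

/-! ### Elementary steps -/

/-- From a complex estimate `‖T − m·S‖ ≤ B` for `T = X` (`X, m, S` real) to `|X − m S| ≤ B`.
[folklore] -/
theorem abs_sub_le_of_norm_sub_le {X m S B : ℝ} {T : ℂ} (hX : (X : ℂ) = T)
    (hT : ‖T - ((m * S : ℝ) : ℂ)‖ ≤ B) : |X - m * S| ≤ B := by
  rw [← hX, ← Complex.ofReal_sub, Complex.norm_real, Real.norm_eq_abs] at hT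
  exact hT

/-- The main term of Lemma 3 in the notation `mainTerm`: `C(u+v,u)(log R)^{u+v+d}/(u+v+d)!
= mainTerm A B E R` when `u + v = A`, `u = B`, `u + v + d = E`. [cite: GoldstonPintzYildirim2009, Section 8 eq. 8.5] -/
theorem choose_mul_log_pow_div_eq_mainTerm {u v d A B E : ℕ} (hA : u + v = A) (hB : u = B)
    (hE : u + v + d = E) (R : ℝ) :
    ((u + v).choose u : ℝ) * Real.log R ^ (u + v + d) / ((u + v + d).factorial : ℝ) =
      mainTerm A B E R := by
  subst hA hB hE
  rfl

/-- `ε (log R)^E ≤ δ · mainTerm A B E R` once `ε ≤ δ/E!` (`B ≤ A`, `R ≥ 1`, `δ ≥ 0`):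
`mainTerm = C(A,B)(log R)^E/E! ≥ (log R)^E/E!`. [folklore] -/
theorem eps_mul_log_pow_le_mul_mainTerm {A B E : ℕ} (hBA : B ≤ A) {R δ ε : ℝ} (hR : 1 ≤ R)
    (hδ : 0 ≤ δ) (hε : ε ≤ δ / (E.factorial : ℝ)) :
    ε * Real.log R ^ E ≤ δ * mainTerm A B E R := by
  have hL : 0 ≤ Real.log R ^ E := pow_nonneg (Real.log_nonneg hR) _
  have hC : (1 : ℝ) ≤ A.choose B := by exact_mod_cast Nat.choose_pos hBA
  have hf : (0 : ℝ) < E.factorial := by exact_mod_cast Nat.factorial_pos E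
  unfold mainTerm
  calc ε * Real.log R ^ E ≤ δ / E.factorial * Real.log R ^ E := mul_le_mul_of_nonneg_right hε hL
    _ = δ * (1 * Real.log R ^ E / E.factorial) := by ring
    _ ≤ δ * ((A.choose B : ℝ) * Real.log R ^ E / E.factorial) := by
        refine mul_le_mul_of_nonneg_left ?_ hδ
        exact div_le_div_of_nonneg_right (mul_le_mul_of_nonneg_right hC hL) hf.le

/-- `δ/(M+2)! ≤ δ/E!` for `E ≤ M + 2`, `δ ≥ 0`. [folklore] -/
theorem div_factorial_le_div_factorial {E M : ℕ} (hE : E ≤ M + 2) {δ : ℝ} (hδ : 0 ≤ δ) :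
    δ / ((M + 2).factorial : ℝ) ≤ δ / (E.factorial : ℝ) := by
  have hf : (0 : ℝ) < E.factorial := by exact_mod_cast Nat.factorial_pos E
  refine div_le_div_of_nonneg_left hδ hf ?_
  exact_mod_cast Nat.factorial_le hE

/-- `a ≥ k₁ − 1`, i.e. `k₁ ≤ a + 1`. [cite: GoldstonPintzYildirim2009, Section 9 eq. 9.18] -/
theorem card_le_caseA_add_one (h₀ : ℕ) (H₁ : Finset ℕ) : #H₁ ≤ caseA h₀ H₁ + 1 := by
  unfold caseA
  have := Finset.pred_card_le_card_erase (s := H₁) (a := h₀)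
  omega

/-- `caseA h₀ ∅ = 0`. [folklore] -/
theorem caseA_empty (h₀ : ℕ) : caseA h₀ (∅ : Finset ℕ) = 0 := by simp [caseA]

/-- `caseD h₀ H₁ ∅ = 0`. [folklore] -/
theorem caseD_empty_right (h₀ : ℕ) (H₁ : Finset ℕ) : caseD h₀ H₁ (∅ : Finset ℕ) = 0 := by
  simp [caseD]

/-! ### The core reductions -/

/-- **Both `Hᵢ` nonempty**: an estimate for `𝒯*_R(a,b,d,u,v)` with `G = GStar` at the case exponents,
`a + u = K₁`, `b + v = K₂`, is an estimate for `𝒯̃_R` (`mainTRTheta_eq_lemma3T`).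
[cite: GoldstonPintzYildirim2009, Section 9 eq. 9.15] -/
theorem abs_mainTRTheta_sub_le_of_lemma3T {R : ℝ} (hR : 0 < R) {h₀ : ℕ} {H₁ H₂ : Finset ℕ}
    (h₁ : H₁.Nonempty) (h₂ : H₂.Nonempty) {ℓ₁ ℓ₂ u v : ℕ} (hu : caseA h₀ H₁ + u = #H₁ + ℓ₁)
    (hv : caseA h₀ H₂ + v = #H₂ + ℓ₂) {m B : ℝ}
    (hT : ‖lemma3T (fun s₁ s₂ => GStar h₀ H₁ H₂ (caseA h₀ H₁) (caseA h₀ H₂) (caseD h₀ H₁ H₂) s₁ s₂) R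
        (caseA h₀ H₁) (caseA h₀ H₂) (caseD h₀ H₁ H₂) u v -
        ((m * singularSeriesNat (insert h₀ (H₁ ∪ H₂)) : ℝ) : ℂ)‖ ≤ B) :
    |mainTRTheta R H₁ H₂ ℓ₁ ℓ₂ h₀ - m * singularSeriesNat (insert h₀ (H₁ ∪ H₂))| ≤ B := by
  have ha : caseA h₀ H₁ ≤ #H₁ + ℓ₁ := by omega
  have hb : caseA h₀ H₂ ≤ #H₂ + ℓ₂ := by omega
  have hX := mainTRTheta_eq_lemma3T hR h₀ h₁ h₂ ℓ₁ ℓ₂ (caseD h₀ H₁ H₂) ha hb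
  rw [show #H₁ + ℓ₁ - caseA h₀ H₁ = u by omega, show #H₂ + ℓ₂ - caseA h₀ H₂ = v by omega] at hX
  exact abs_sub_le_of_norm_sub_le hX hT

/-- **`H₂ = ∅`** (`H₁` nonempty, `a + u = K₁`): an estimate
`‖𝒯*_R(a,0,0,u,1) − C(u+1,u)(log R)^{u+1}/(u+1)! 𝔖‖ ≤ ε (log R)^{u+1}` (dummy second variable)
gives `|𝒯̃_R(H₁,∅,ℓ₁,0,h₀) − (log R)^u/u! · 𝔖| ≤ ε (log R)^u` (`R > 1`).
[cite: GoldstonPintzYildirim2009, Section 9 eq. 9.15] -/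
theorem abs_mainTRTheta_empty_sub_le_of_lemma3T {R : ℝ} (hR : 1 < R) {h₀ : ℕ} {H₁ : Finset ℕ}
    (h₁ : H₁.Nonempty) {ℓ₁ u : ℕ} (hu : caseA h₀ H₁ + u = #H₁ + ℓ₁) {ε : ℝ}
    (hT : ‖lemma3T (fun s₁ s₂ => GStar h₀ H₁ ∅ (caseA h₀ H₁) (caseA h₀ ∅) (caseD h₀ H₁ ∅) s₁ s₂) R
        (caseA h₀ H₁) (caseA h₀ ∅) (caseD h₀ H₁ ∅) u 1 -
        ((((u + 1).choose u : ℝ) * Real.log R ^ (u + 1 + caseD h₀ H₁ ∅) /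
            ((u + 1 + caseD h₀ H₁ ∅).factorial : ℝ) *
          singularSeriesNat (insert h₀ (H₁ ∪ ∅)) : ℝ) : ℂ)‖ ≤
        ε * Real.log R ^ (u + 1 + caseD h₀ H₁ ∅)) :
    |mainTRTheta R H₁ ∅ ℓ₁ 0 h₀ -
        Real.log R ^ u / (u.factorial : ℝ) * singularSeriesNat (insert h₀ (H₁ ∪ ∅))| ≤
      ε * Real.log R ^ u := by
  have hR0 : 0 < R := by linarith
  have hlog : 0 < Real.log R := Real.log_pos hR
  have ha : caseA h₀ H₁ ≤ #H₁ + ℓ₁ := by omega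
  rw [caseA_empty, caseD_empty_right, add_zero] at hT
  have hX := mainTRTheta_empty_mul_log_eq_lemma3T hR0 h₀ h₁ ℓ₁ ha
  rw [show #H₁ + ℓ₁ - caseA h₀ H₁ = u by omega] at hX
  rw [← hX] at hT
  -- `C(u+1,u)(log R)^{u+1}/(u+1)! = log R · (log R)^u/u!`
  have hmain : (((u + 1).choose u : ℝ) * Real.log R ^ (u + 1) / ((u + 1).factorial : ℝ)) =
      Real.log R * (Real.log R ^ u / (u.factorial : ℝ)) := by
    rw [Nat.choose_succ_self_right, Nat.factorial_succ, pow_succ]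
    have hf : ((u.factorial : ℕ) : ℝ) ≠ 0 := by exact_mod_cast (Nat.factorial_pos u).ne'
    have hu1 : ((u + 1 : ℕ) : ℝ) ≠ 0 := by exact_mod_cast Nat.succ_ne_zero u
    push_cast
    field_simp
  rw [hmain] at hT
  set S := singularSeriesNat (insert h₀ (H₁ ∪ ∅)) with hS
  set X := mainTRTheta R H₁ ∅ ℓ₁ 0 h₀ with hXdef
  have hfac : (X : ℂ) * (Real.log R : ℂ) - ((Real.log R * (Real.log R ^ u / (u.factorial : ℝ)) * S : ℝ) : ℂ) =
      (Real.log R : ℂ) * ((X - Real.log R ^ u / (u.factorial : ℝ) * S : ℝ) : ℂ) := by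
    push_cast; ring
  rw [hfac, norm_mul, Complex.norm_real, Real.norm_eq_abs, abs_of_pos hlog, pow_succ,
    show ε * (Real.log R ^ u * Real.log R) = Real.log R * (ε * Real.log R ^ u) by ring] at hT
  rw [Complex.norm_real, Real.norm_eq_abs] at hT
  exact le_of_mul_le_mul_left hT hlog

/-! ### Proposition 2 from Lemma 3 for `GStar` -/

/-- **The main-term statement of Proposition 2 from Lemma 3** (GPY §9, last paragraph, and the
one-empty case): if Lemma 3 holds for `G = GStar` at the case exponents in the `o(1)`-form `hL3`
(uniformly in `h ≤ R`, `Hᵢ ⊆ [0,h]`, `1 ≤ h₀ ≤ h`, `k₁ + k₂ + u + v ≤ M`; main term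
`C(u+v,u)(log R)^{u+v+d}/(u+v+d)! 𝔖(H⁰)`, `G(0,0) = 𝔖(H⁰)` by `GStar_zero_zero`), then the
hypothesis `hMT` of `proposition2_of_mainTerm` holds: Case 1 `(a,b,d,u,v) = (k₁,k₂,r,ℓ₁,ℓ₂)`,
Case 2 `(k₁−1,k₂,r,ℓ₁+1,ℓ₂)`, Case 3 `(k₁−1,k₂−1,r−1,ℓ₁+1,ℓ₂+1)`; `H₂ = ∅` via `v = 1` and
division by `log R`; `H₁ = ∅` via `mainTRTheta_comm`; `ε = δ/(M+2)!`.
[cite: GoldstonPintzYildirim2009, Section 9 eq. 9.21] -/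
theorem mainTerm_of_lemma3
    (hL3 : ∀ (M : ℕ) (ε : ℝ), 0 < ε → ∃ R₁ : ℝ, ∀ (R : ℝ) (h h₀ : ℕ) (H₁ H₂ : Finset ℕ) (u v : ℕ),
      R₁ ≤ R → (h : ℝ) ≤ R → 1 ≤ h₀ → h₀ ≤ h → (∀ x ∈ H₁, x ≤ h) → (∀ x ∈ H₂, x ≤ h) →
      1 ≤ #H₁ + #H₂ → #H₁ + #H₂ + u + v ≤ M → 1 ≤ caseA h₀ H₁ + u → 1 ≤ caseA h₀ H₂ + v →
      ‖lemma3T (fun s₁ s₂ => GStar h₀ H₁ H₂ (caseA h₀ H₁) (caseA h₀ H₂) (caseD h₀ H₁ H₂) s₁ s₂) R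
          (caseA h₀ H₁) (caseA h₀ H₂) (caseD h₀ H₁ H₂) u v -
        ((((u + v).choose u : ℝ) * Real.log R ^ (u + v + caseD h₀ H₁ H₂) /
            ((u + v + caseD h₀ H₁ H₂).factorial : ℝ) *
          singularSeriesNat (insert h₀ (H₁ ∪ H₂)) : ℝ) : ℂ)‖ ≤
        ε * Real.log R ^ (u + v + caseD h₀ H₁ H₂)) :
    ∀ (M : ℕ) (δ : ℝ), 0 < δ → ∃ R₀ : ℝ, ∀ (R : ℝ) (h h₀ : ℕ) (H₁ H₂ : Finset ℕ) (ℓ₁ ℓ₂ : ℕ),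
      R₀ ≤ R → (h : ℝ) ≤ R → 1 ≤ h₀ → h₀ ≤ h →
      (∀ x ∈ H₁, x ≤ h) → (∀ x ∈ H₂, x ≤ h) → (H₁.Nonempty ∨ H₂.Nonempty) →
      ℓ₁ ≤ #H₁ → ℓ₂ ≤ #H₂ → #H₁ + #H₂ + ℓ₁ + ℓ₂ = M →
      (h₀ ∉ H₁ ∪ H₂ →
        |mainTRTheta R H₁ H₂ ℓ₁ ℓ₂ h₀ -
            mainTerm (ℓ₁ + ℓ₂) ℓ₁ (#(H₁ ∩ H₂) + ℓ₁ + ℓ₂) R *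
              singularSeriesNat (insert h₀ (H₁ ∪ H₂))| ≤
          δ * mainTerm (ℓ₁ + ℓ₂) ℓ₁ (#(H₁ ∩ H₂) + ℓ₁ + ℓ₂) R) ∧
      (h₀ ∈ H₁ → h₀ ∉ H₂ →
        |mainTRTheta R H₁ H₂ ℓ₁ ℓ₂ h₀ -
            mainTerm (ℓ₁ + ℓ₂ + 1) (ℓ₁ + 1) (#(H₁ ∩ H₂) + ℓ₁ + ℓ₂ + 1) R *
              singularSeriesNat (H₁ ∪ H₂)| ≤
          δ * mainTerm (ℓ₁ + ℓ₂ + 1) (ℓ₁ + 1) (#(H₁ ∩ H₂) + ℓ₁ + ℓ₂ + 1) R) ∧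
      (h₀ ∈ H₁ ∩ H₂ →
        |mainTRTheta R H₁ H₂ ℓ₁ ℓ₂ h₀ -
            mainTerm (ℓ₁ + ℓ₂ + 2) (ℓ₁ + 1) (#(H₁ ∩ H₂) + ℓ₁ + ℓ₂ + 1) R *
              singularSeriesNat (H₁ ∪ H₂)| ≤
          δ * mainTerm (ℓ₁ + ℓ₂ + 2) (ℓ₁ + 1) (#(H₁ ∩ H₂) + ℓ₁ + ℓ₂ + 1) R) := by
  intro M δ hδ
  set ε : ℝ := δ / ((M + 2).factorial : ℝ) with hεdef
  have hε : 0 < ε := div_pos hδ (by exact_mod_cast Nat.factorial_pos _)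
  obtain ⟨R₁, hR₁⟩ := hL3 (M + 2) ε hε
  refine ⟨max R₁ 3, ?_⟩
  intro R h h₀ H₁ H₂ ℓ₁ ℓ₂ hR hh h1 hh₀ hH₁ hH₂ hne hℓ₁ hℓ₂ hM
  have hRR₁ : R₁ ≤ R := (le_max_left _ _).trans hR
  have hR3 : (3 : ℝ) ≤ R := (le_max_right _ _).trans hR
  have hRgt : 1 < R := by linarith
  have hRge : 1 ≤ R := hRgt.le
  have hR0 : 0 < R := by linarith
  have hεE : ∀ {E : ℕ}, E ≤ M + 2 → ε ≤ δ / (E.factorial : ℝ) := fun hE =>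
    div_factorial_le_div_factorial hE hδ.le
  -- the Lemma 3 instance at the fixed `R, h, h₀`
  have L : ∀ (H₁ H₂ : Finset ℕ) (u v : ℕ), (∀ x ∈ H₁, x ≤ h) → (∀ x ∈ H₂, x ≤ h) →
      1 ≤ #H₁ + #H₂ → #H₁ + #H₂ + u + v ≤ M + 2 → 1 ≤ caseA h₀ H₁ + u → 1 ≤ caseA h₀ H₂ + v →
      ‖lemma3T (fun s₁ s₂ => GStar h₀ H₁ H₂ (caseA h₀ H₁) (caseA h₀ H₂) (caseD h₀ H₁ H₂) s₁ s₂) R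
          (caseA h₀ H₁) (caseA h₀ H₂) (caseD h₀ H₁ H₂) u v -
        ((((u + v).choose u : ℝ) * Real.log R ^ (u + v + caseD h₀ H₁ H₂) /
            ((u + v + caseD h₀ H₁ H₂).factorial : ℝ) *
          singularSeriesNat (insert h₀ (H₁ ∪ H₂)) : ℝ) : ℂ)‖ ≤
        ε * Real.log R ^ (u + v + caseD h₀ H₁ H₂) :=
    fun H₁ H₂ u v => hR₁ R h h₀ H₁ H₂ u v hRR₁ hh h1 hh₀
  have hr₁ : #(H₁ ∩ H₂) ≤ #H₁ := Finset.card_le_card Finset.inter_subset_left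
  have hr₂ : #(H₁ ∩ H₂) ≤ #H₂ := Finset.card_le_card Finset.inter_subset_right
  refine ⟨fun hU => ?_, fun hin₁ hn₂ => ?_, fun hin => ?_⟩
  · -- Case 1: `h₀ ∉ H₁ ∪ H₂`
    have hn₁ : h₀ ∉ H₁ := fun h' => hU (Finset.mem_union_left _ h')
    have hn₂ : h₀ ∉ H₂ := fun h' => hU (Finset.mem_union_right _ h')
    have hA₁ : caseA h₀ H₁ = #H₁ := caseA_of_not_mem hn₁
    have hA₂ : caseA h₀ H₂ = #H₂ := caseA_of_not_mem hn₂
    have hD : caseD h₀ H₁ H₂ = #(H₁ ∩ H₂) :=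
      caseD_of_not_mem (fun h' => hn₁ (Finset.mem_inter.1 h').1)
    rcases H₂.eq_empty_or_nonempty with rfl | h₂ne
    · -- `H₂ = ∅`
      have h₁ne : H₁.Nonempty := hne.resolve_right Finset.not_nonempty_empty
      have hk₁ : 1 ≤ #H₁ := h₁ne.card_pos
      have hℓ₂0 : ℓ₂ = 0 := by simpa using hℓ₂
      subst hℓ₂0
      simp only [Finset.card_empty, add_zero] at hM
      have hT := L H₁ ∅ ℓ₁ 1 hH₁ (by simp) (by simpa using hk₁) (by simp; omega)
        (by rw [hA₁]; omega) (by simp [caseA_empty])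
      have hb := abs_mainTRTheta_empty_sub_le_of_lemma3T hRgt h₁ne (ℓ₁ := ℓ₁) (u := ℓ₁) (by rw [hA₁]) hT
      simp only [Finset.inter_empty, Finset.card_empty, zero_add, add_zero, Finset.union_empty] at hb ⊢
      rw [show Real.log R ^ ℓ₁ / (ℓ₁.factorial : ℝ) = mainTerm ℓ₁ ℓ₁ ℓ₁ R by simp [mainTerm]] at hb
      exact hb.trans (eps_mul_log_pow_le_mul_mainTerm le_rfl hRge hδ.le (hεE (by omega)))
    rcases H₁.eq_empty_or_nonempty with rfl | h₁ne
    · -- `H₁ = ∅`: symmetry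
      have hk₂ : 1 ≤ #H₂ := h₂ne.card_pos
      have hℓ₁0 : ℓ₁ = 0 := by simpa using hℓ₁
      subst hℓ₁0
      simp only [Finset.card_empty, zero_add, add_zero] at hM
      rw [mainTRTheta_comm]
      have hT := L H₂ ∅ ℓ₂ 1 hH₂ (by simp) (by simpa using hk₂) (by simp; omega)
        (by rw [hA₂]; omega) (by simp [caseA_empty])
      have hb := abs_mainTRTheta_empty_sub_le_of_lemma3T hRgt h₂ne (ℓ₁ := ℓ₂) (u := ℓ₂) (by rw [hA₂]) hT
      simp only [Finset.empty_inter, Finset.card_empty, zero_add, add_zero, Finset.union_empty,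
        Finset.empty_union] at hb ⊢
      rw [show Real.log R ^ ℓ₂ / (ℓ₂.factorial : ℝ) = mainTerm ℓ₂ 0 ℓ₂ R by simp [mainTerm]] at hb
      exact hb.trans (eps_mul_log_pow_le_mul_mainTerm (Nat.zero_le _) hRge hδ.le (hεE (by omega)))
    · -- both nonempty
      have hk₁ : 1 ≤ #H₁ := h₁ne.card_pos
      have hk₂ : 1 ≤ #H₂ := h₂ne.card_pos
      have hT := L H₁ H₂ ℓ₁ ℓ₂ hH₁ hH₂ (by omega) (by omega) (by rw [hA₁]; omega)
        (by rw [hA₂]; omega)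
      have hb := abs_mainTRTheta_sub_le_of_lemma3T hR0 h₁ne h₂ne (ℓ₁ := ℓ₁) (ℓ₂ := ℓ₂) (u := ℓ₁) (v := ℓ₂)
        (by rw [hA₁]) (by rw [hA₂]) hT
      rw [hD] at hb
      rw [choose_mul_log_pow_div_eq_mainTerm (A := ℓ₁ + ℓ₂) (B := ℓ₁) (E := #(H₁ ∩ H₂) + ℓ₁ + ℓ₂)
        rfl rfl (by ring) R,
        show ℓ₁ + ℓ₂ + #(H₁ ∩ H₂) = #(H₁ ∩ H₂) + ℓ₁ + ℓ₂ by ring] at hb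
      exact hb.trans (eps_mul_log_pow_le_mul_mainTerm (by omega) hRge hδ.le (hεE (by omega)))
  · -- Case 2: `h₀ ∈ H₁`, `h₀ ∉ H₂`
    have h₁ne : H₁.Nonempty := ⟨h₀, hin₁⟩
    have hk₁ : 1 ≤ #H₁ := h₁ne.card_pos
    have hA₁ : caseA h₀ H₁ = #H₁ - 1 := caseA_of_mem hin₁
    have hA₂ : caseA h₀ H₂ = #H₂ := caseA_of_not_mem hn₂
    have hD : caseD h₀ H₁ H₂ = #(H₁ ∩ H₂) :=
      caseD_of_not_mem (fun h' => hn₂ (Finset.mem_inter.1 h').2)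
    have hins : insert h₀ (H₁ ∪ H₂) = H₁ ∪ H₂ :=
      Finset.insert_eq_of_mem (Finset.mem_union_left _ hin₁)
    rcases H₂.eq_empty_or_nonempty with rfl | h₂ne
    · -- `H₂ = ∅`
      have hℓ₂0 : ℓ₂ = 0 := by simpa using hℓ₂
      subst hℓ₂0
      simp only [Finset.card_empty, add_zero] at hM
      have hT := L H₁ ∅ (ℓ₁ + 1) 1 hH₁ (by simp) (by simpa using hk₁) (by simp; omega)
        (by omega) (by simp [caseA_empty])
      have hb := abs_mainTRTheta_empty_sub_le_of_lemma3T hRgt h₁ne (ℓ₁ := ℓ₁) (u := ℓ₁ + 1)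
        (by rw [hA₁]; omega) hT
      have hins' : insert h₀ (H₁ ∪ ∅) = H₁ ∪ ∅ := by
        rw [Finset.union_empty]; exact Finset.insert_eq_of_mem hin₁
      rw [hins'] at hb
      simp only [Finset.inter_empty, Finset.card_empty, zero_add, add_zero, Finset.union_empty] at hb ⊢
      rw [show Real.log R ^ (ℓ₁ + 1) / ((ℓ₁ + 1).factorial : ℝ) = mainTerm (ℓ₁ + 1) (ℓ₁ + 1) (ℓ₁ + 1) R
        by simp [mainTerm]] at hb
      exact hb.trans (eps_mul_log_pow_le_mul_mainTerm le_rfl hRge hδ.le (hεE (by omega)))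
    · -- both nonempty
      have hk₂ : 1 ≤ #H₂ := h₂ne.card_pos
      have hT := L H₁ H₂ (ℓ₁ + 1) ℓ₂ hH₁ hH₂ (by omega) (by omega) (by omega) (by rw [hA₂]; omega)
      have hb := abs_mainTRTheta_sub_le_of_lemma3T hR0 h₁ne h₂ne (ℓ₁ := ℓ₁) (ℓ₂ := ℓ₂) (u := ℓ₁ + 1) (v := ℓ₂)
        (by rw [hA₁]; omega) (by rw [hA₂]) hT
      rw [hD, hins] at hb
      rw [choose_mul_log_pow_div_eq_mainTerm (A := ℓ₁ + ℓ₂ + 1) (B := ℓ₁ + 1)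
        (E := #(H₁ ∩ H₂) + ℓ₁ + ℓ₂ + 1) (by ring) rfl (by ring) R,
        show ℓ₁ + 1 + ℓ₂ + #(H₁ ∩ H₂) = #(H₁ ∩ H₂) + ℓ₁ + ℓ₂ + 1 by ring] at hb
      exact hb.trans (eps_mul_log_pow_le_mul_mainTerm (by omega) hRge hδ.le (hεE (by omega)))
  · -- Case 3: `h₀ ∈ H₁ ∩ H₂`
    have hin₁ : h₀ ∈ H₁ := (Finset.mem_inter.1 hin).1
    have hin₂ : h₀ ∈ H₂ := (Finset.mem_inter.1 hin).2
    have h₁ne : H₁.Nonempty := ⟨h₀, hin₁⟩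
    have h₂ne : H₂.Nonempty := ⟨h₀, hin₂⟩
    have hk₁ : 1 ≤ #H₁ := h₁ne.card_pos
    have hk₂ : 1 ≤ #H₂ := h₂ne.card_pos
    have hr1 : 1 ≤ #(H₁ ∩ H₂) := Finset.card_pos.2 ⟨h₀, hin⟩
    have hA₁ : caseA h₀ H₁ = #H₁ - 1 := caseA_of_mem hin₁
    have hA₂ : caseA h₀ H₂ = #H₂ - 1 := caseA_of_mem hin₂
    have hD : caseD h₀ H₁ H₂ = #(H₁ ∩ H₂) - 1 := caseD_of_mem hin
    have hins : insert h₀ (H₁ ∪ H₂) = H₁ ∪ H₂ :=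
      Finset.insert_eq_of_mem (Finset.mem_union_left _ hin₁)
    have hT := L H₁ H₂ (ℓ₁ + 1) (ℓ₂ + 1) hH₁ hH₂ (by omega) (by omega) (by omega) (by omega)
    have hb := abs_mainTRTheta_sub_le_of_lemma3T hR0 h₁ne h₂ne (ℓ₁ := ℓ₁) (ℓ₂ := ℓ₂) (u := ℓ₁ + 1) (v := ℓ₂ + 1)
      (by rw [hA₁]; omega) (by rw [hA₂]; omega) hT
    rw [hD, hins] at hb
    rw [choose_mul_log_pow_div_eq_mainTerm (A := ℓ₁ + ℓ₂ + 2) (B := ℓ₁ + 1)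
      (E := #(H₁ ∩ H₂) + ℓ₁ + ℓ₂ + 1) (by ring) rfl (by omega) R,
      show ℓ₁ + 1 + (ℓ₂ + 1) + (#(H₁ ∩ H₂) - 1) = #(H₁ ∩ H₂) + ℓ₁ + ℓ₂ + 1 by omega] at hb
    exact hb.trans (eps_mul_log_pow_le_mul_mainTerm (by omega) hRge hδ.le (hεE (by omega)))

/-- **Proposition 2 from Lemma 3 for `GStar`**: `hL3 → proposition2`
(`proposition2_of_mainTerm ∘ mainTerm_of_lemma3`). [cite: GoldstonPintzYildirim2009, Proposition 2] -/
theorem proposition2_of_lemma3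
    (hL3 : ∀ (M : ℕ) (ε : ℝ), 0 < ε → ∃ R₁ : ℝ, ∀ (R : ℝ) (h h₀ : ℕ) (H₁ H₂ : Finset ℕ) (u v : ℕ),
      R₁ ≤ R → (h : ℝ) ≤ R → 1 ≤ h₀ → h₀ ≤ h → (∀ x ∈ H₁, x ≤ h) → (∀ x ∈ H₂, x ≤ h) →
      1 ≤ #H₁ + #H₂ → #H₁ + #H₂ + u + v ≤ M → 1 ≤ caseA h₀ H₁ + u → 1 ≤ caseA h₀ H₂ + v →
      ‖lemma3T (fun s₁ s₂ => GStar h₀ H₁ H₂ (caseA h₀ H₁) (caseA h₀ H₂) (caseD h₀ H₁ H₂) s₁ s₂) R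
          (caseA h₀ H₁) (caseA h₀ H₂) (caseD h₀ H₁ H₂) u v -
        ((((u + v).choose u : ℝ) * Real.log R ^ (u + v + caseD h₀ H₁ H₂) /
            ((u + v + caseD h₀ H₁ H₂).factorial : ℝ) *
          singularSeriesNat (insert h₀ (H₁ ∪ H₂)) : ℝ) : ℂ)‖ ≤
        ε * Real.log R ^ (u + v + caseD h₀ H₁ H₂)) :
    proposition2 :=
  proposition2_of_mainTerm (mainTerm_of_lemma3 hL3)

end Literature.NumberTheory.Sieve.GPY
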